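import Summits.QuantumFields.QCD.Theorems.TransparentRPWallLabelledConeChainDensityOneGap

/-!
PROVENANCE.  Strategist-written candidate proof (planner-cstrat-stmt-QuantumFields-9910-r1-0, 2026-08-17; tree copy
`Summits/QuantumFields/QCD/Cruxes/LabelledPlanarSpectralCone/Proof.lean`, 1499 lines, lean check rc 0 / 0 sorries / 0 warnings
against the tree of 2026-08-28), landed VERBATIM in ≤ 400-line parts under `Theorems/` by width seat ym-t4-w17 g0 (free hands):
parts `…LabelledConeDiscSections` (X₁), `…LabelledConeChainDensity{Kinematics,Sector,OneGap,}` (X₂), `…LabelledPlanarSpectralConeSplit`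
(glue), and the by-name closers `…Holds`.  Statements are INLINE (no route import), so these parts are route-independent.
-/

noncomputable section

namespace Summit.QuantumFields.QCD.Theorems.LabelledConeChainDensityProof

open MeasureTheory Complex Set Filter
open scoped InnerProductSpace SchwartzMap ComplexConjugate Topology
open Literature.MathematicalPhysics.QuantumLattice Literature.MathematicalPhysics.AQFT
  Literature.MathematicalPhysics.QuantumFieldTheory
open Summit.QuantumFields.YangMills.Cruxes.PlanarSpectralCone.PositivityDiscToOperatorCone
open Summit.QuantumFields.YangMills.Cruxes.PlanarSpectralCone.PositivityDiscToOperatorCone.OneGap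
open Literature.Analysis.Complex


namespace DensityL

/-! ### D. First-gap absorption and the induction over the leading gaps (labelled) -/

/-- **First-gap absorption, LABELLED.** A vector `χ` orthogonal to the field vectors of all strict
cone chains (all label strings) is orthogonal to `Ψ^κ_F` for every time-ordered `F` that is internally
cone-ordered with `|xᵢ¹| ≤ D` on its support. -/
theorem inner_fieldVec_eq_zero_of_internallyConed_labelled {ι : Type} (S : LabelledSchwingerFamily ι (EuclideanSpace ℝ (Fin 4)))
    (h : OSReconstructionNoE1 S) (χ : h.Hilbert)
    (hχ : ∀ (m : ℕ) (κ : Fin m → ι) (G : 𝓢((Fin m → (EuclideanSpace ℝ (Fin 4))), ℂ)) (hG : IsTimeOrdered G),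
      tsupport (G : (Fin m → (EuclideanSpace ℝ (Fin 4))) → ℂ) ⊆
        {x | (∀ i, |x i 1| < x i 0) ∧ ∀ i j, i < j → |x j 1 - x i 1| < x j 0 - x i 0} →
      ⟪χ, h.fieldVec m κ G hG⟫_ℂ = 0)
    {m : ℕ} (κ : Fin m → ι) (F : 𝓢((Fin m → (EuclideanSpace ℝ (Fin 4))), ℂ)) (hF : IsTimeOrdered F) (D : ℝ)
    (hFD : tsupport (F : (Fin m → (EuclideanSpace ℝ (Fin 4))) → ℂ) ⊆
        {x | (∀ i, |x i 1| ≤ D) ∧ ∀ i j, i < j → |x j 1 - x i 1| < x j 0 - x i 0}) :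
    ⟪χ, h.fieldVec m κ F hF⟫_ℂ = 0 := by
  set ψF := h.fieldVec m κ F hF with hψF
  -- Step 1: beyond `max D 0` the translated function is a cone chain
  have step1 : ∀ s : ℝ, max D 0 < s → ⟪χ, h.transfer s ψF⟫_ℂ = 0 := by
    intro s hs
    have hs0 : 0 ≤ s := le_trans (le_max_right _ _) hs.le
    rw [hψF, h.transfer_fieldVec hs0]
    exact hχ m κ _ _ (Density.coneChain_translate_timeVec F hF D hFD hs)
  -- Step 2: the holomorphic function (complex-time matrix element at `a = 0`)
  obtain ⟨-, g, hgd', -, -, hgr⟩ :=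
    Summit.QuantumFields.YangMills.Cruxes.PlanarSpectralCone.TwoMirrorLightconeSlots.stub_complexTimeSlot h χ ψF
  have hgd : DifferentiableOn ℂ (g 0) {τ : ℂ | 0 < τ.re} := hgd' 0
  have hg_real : ∀ x : ℝ, 0 < x → g 0 x = ⟪χ, h.transfer x ψF⟫_ℂ := fun x hx => by
    rw [hgr 0 rfl x hx, h.translate_zero_apply]
  -- Step 3: identity theorem on the right half-plane
  have hU : IsOpen {τ : ℂ | 0 < τ.re} := isOpen_lt continuous_const Complex.continuous_re
  have hUc : IsPreconnected {τ : ℂ | 0 < τ.re} := (convex_halfSpace_re_gt 0).isPreconnected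
  have hga : AnalyticOnNhd ℂ (g 0) {τ : ℂ | 0 < τ.re} := hgd.analyticOnNhd hU
  set c : ℝ := max D 0 + 1 with hc
  have hc0 : 0 < c := by rw [hc]; positivity
  have hz₀ : ((c : ℝ) : ℂ) ∈ {τ : ℂ | 0 < τ.re} := by simpa using hc0
  have hfreq : ∃ᶠ z in 𝓝[≠] ((c : ℝ) : ℂ), g 0 z = 0 := by
    set u : ℕ → ℂ := fun n => (((c + 1 / ((n : ℝ) + 1) : ℝ)) : ℂ) with hu
    have hut : Tendsto u atTop (𝓝[≠] ((c : ℝ) : ℂ)) := by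
      rw [tendsto_nhdsWithin_iff]
      refine ⟨?_, Eventually.of_forall fun n => ?_⟩
      · have h1 : Tendsto (fun n : ℕ => c + 1 / ((n : ℝ) + 1)) atTop (𝓝 (c + 0)) :=
          (tendsto_const_nhds (x := c) (f := (atTop : Filter ℕ))).add
            tendsto_one_div_add_atTop_nhds_zero_nat
        rw [add_zero] at h1
        exact (Complex.continuous_ofReal.tendsto c).comp h1
      · simp only [hu, Set.mem_compl_iff, Set.mem_singleton_iff, Complex.ofReal_inj]
        have : 0 < 1 / ((n : ℝ) + 1) := by positivity
        linarith
    have hall : ∀ n, g 0 (u n) = 0 := by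
      intro n
      have hpos : 0 < c + 1 / ((n : ℝ) + 1) := by positivity
      have hgt : max D 0 < c + 1 / ((n : ℝ) + 1) := by
        have : 0 < 1 / ((n : ℝ) + 1) := by positivity
        rw [hc]; linarith
      simp only [hu]
      rw [hg_real _ hpos]
      exact step1 _ hgt
    exact hut.frequently (Frequently.of_forall hall)
  have hzero : EqOn (g 0) 0 {τ : ℂ | 0 < τ.re} :=
    hga.eqOn_zero_of_preconnected_of_frequently_eq_zero hUc hz₀ hfreq
  -- Step 4: all positive times
  have step4 : ∀ x : ℝ, 0 < x → ⟪χ, h.transfer x ψF⟫_ℂ = 0 := by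
    intro x hx
    rw [← hg_real x hx]
    exact hzero (by simpa using hx)
  -- Step 5: strong continuity at `0`
  have hcont : Continuous fun t : ℝ => ⟪χ, h.transfer t ψF⟫_ℂ :=
    (continuous_const : Continuous fun _ : ℝ => χ).inner (h.continuous_transfer_apply ψF)
  have hlim : Tendsto (fun t : ℝ => ⟪χ, h.transfer t ψF⟫_ℂ) (𝓝[>] 0)
      (𝓝 ⟪χ, h.transfer 0 ψF⟫_ℂ) :=
    (hcont.tendsto 0).mono_left nhdsWithin_le_nhds
  have hlim0 : Tendsto (fun t : ℝ => ⟪χ, h.transfer t ψF⟫_ℂ) (𝓝[>] 0) (𝓝 0) := by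
    refine tendsto_const_nhds.congr' ?_
    filter_upwards [self_mem_nhdsWithin] with t ht
    exact (step4 t ht).symm
  have heq := tendsto_nhds_unique hlim hlim0
  rwa [h.transfer_zero, ContinuousLinearMap.id_apply] at heq

/-- **All pairs wide ⇒ orthogonal, LABELLED** (base of the induction). -/
theorem inner_tensorFin_eq_zero_of_allWide_labelled {ι : Type} (S : LabelledSchwingerFamily ι (EuclideanSpace ℝ (Fin 4)))
    (h : OSReconstructionNoE1 S) (χ : h.Hilbert)
    (hχ : ∀ (m : ℕ) (κ : Fin m → ι) (G : 𝓢((Fin m → (EuclideanSpace ℝ (Fin 4))), ℂ)) (hG : IsTimeOrdered G),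
      tsupport (G : (Fin m → (EuclideanSpace ℝ (Fin 4))) → ℂ) ⊆
        {x | (∀ i, |x i 1| < x i 0) ∧ ∀ i j, i < j → |x j 1 - x i 1| < x j 0 - x i 0} →
      ⟪χ, h.fieldVec m κ G hG⟫_ℂ = 0)
    {n : ℕ} (κ : Fin n → ι) {f : Fin n → 𝓢((EuclideanSpace ℝ (Fin 4)), ℂ)} {a b : Fin n → ℝ} {ρ : ℝ}
    (hf : ∀ i, tsupport (f i : (EuclideanSpace ℝ (Fin 4)) → ℂ) ⊆ {x | a i ≤ x 0 ∧ x 0 ≤ b i ∧ |x 1| ≤ ρ})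
    (hwide : ∀ i j, i < j → b i + 2 * ρ < a j) (hG : IsTimeOrdered (SchwartzMap.tensorFin n f)) :
    ⟪χ, h.fieldVec n κ (SchwartzMap.tensorFin n f) hG⟫_ℂ = 0 := by
  refine inner_fieldVec_eq_zero_of_internallyConed_labelled S h χ hχ κ _ hG ρ fun x hx => ?_
  have hw := fun i => hf i (apply_mem_tsupport_of_mem_tsupport_tensorFin f hx i)
  refine ⟨fun i => (hw i).2.2, fun i j hij => ?_⟩
  have h1 : |x j 1 - x i 1| ≤ |x j 1| + |x i 1| := abs_sub _ _
  have h2 := (hw i).2.2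
  have h3 := (hw j).2.2
  have h4 := hwide i j hij
  have h5 := (hw i).2.1
  have h6 := (hw j).1
  show |x j 1 - x i 1| < x j 0 - x i 0
  linarith

/-- **Induction over the leading gaps, LABELLED** (arrow form over the labelled one-gap statement):
`χ ⊥ Ψ^κ_{⊗ fᵢ}` for all windowed data whose pairs of windows from index `J` on are wide. -/
theorem inner_tensorFin_eq_zero_of_wideFrom_labelled {ι : Type} (S : LabelledSchwingerFamily ι (EuclideanSpace ℝ (Fin 4)))
    (h : OSReconstructionNoE1 S)
    (h_oneGap : ∀ {k l : ℕ} (κ : Fin (k + l) → ι) (P : 𝓢((Fin k → (EuclideanSpace ℝ (Fin 4))), ℂ)) (Q : 𝓢((Fin l → (EuclideanSpace ℝ (Fin 4))), ℂ))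
      (T : ℝ), IsTimeOrdered P → IsTimeOrdered Q →
      tsupport (P : (Fin k → (EuclideanSpace ℝ (Fin 4))) → ℂ) ⊆ {x | ∀ i, x i 0 < T} →
      tsupport (Q : (Fin l → (EuclideanSpace ℝ (Fin 4))) → ℂ) ⊆ {x | ∀ i, T < x i 0} →
      ∀ (χ : h.Hilbert) (s₀ : ℝ),
      (∀ s : ℝ, s₀ ≤ s → 0 ≤ s →
        ∀ hs : IsTimeOrdered (P.appendTensor (translateMulti (SchwingerFamily.timeVec s) Q)),
          ⟪χ, h.fieldVec (k + l) κ _ hs⟫_ℂ = 0) →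
      ∀ (s : ℝ), 0 ≤ s →
        ∀ hs : IsTimeOrdered (P.appendTensor (translateMulti (SchwingerFamily.timeVec s) Q)),
          ⟪χ, h.fieldVec (k + l) κ _ hs⟫_ℂ = 0)
    (χ : h.Hilbert)
    (hχ : ∀ (m : ℕ) (κ : Fin m → ι) (G : 𝓢((Fin m → (EuclideanSpace ℝ (Fin 4))), ℂ)) (hG : IsTimeOrdered G),
      tsupport (G : (Fin m → (EuclideanSpace ℝ (Fin 4))) → ℂ) ⊆
        {x | (∀ i, |x i 1| < x i 0) ∧ ∀ i j, i < j → |x j 1 - x i 1| < x j 0 - x i 0} →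
      ⟪χ, h.fieldVec m κ G hG⟫_ℂ = 0)
    (J : ℕ) :
    ∀ (n : ℕ) (κ : Fin n → ι) (f : Fin n → 𝓢((EuclideanSpace ℝ (Fin 4)), ℂ)) (a b : Fin n → ℝ) (ρ : ℝ),
      (∀ i, 0 < a i) → (∀ i j, i < j → b i < a j) →
      (∀ i, tsupport (f i : (EuclideanSpace ℝ (Fin 4)) → ℂ) ⊆ {x | a i ≤ x 0 ∧ x 0 ≤ b i ∧ |x 1| ≤ ρ}) →
      (∀ i j : Fin n, i < j → J ≤ i.val → b i + 2 * ρ < a j) →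
      ∀ hG : IsTimeOrdered (SchwartzMap.tensorFin n f),
        ⟪χ, h.fieldVec n κ (SchwartzMap.tensorFin n f) hG⟫_ℂ = 0 := by
  induction J with
  | zero =>
    intro n κ f a b ρ _ _ hf hwide hG
    exact inner_tensorFin_eq_zero_of_allWide_labelled S h χ hχ κ hf
      (fun i j hij => hwide i j hij (Nat.zero_le _)) hG
  | succ J ih =>
    intro n κ f a b ρ ha hab hf hwide hG
    rcases le_or_gt n (J + 1) with hle | hlt
    · exact ih n κ f a b ρ ha hab hf (fun i j hij hJ => by
        have h1 := j.isLt
        have h2 : (i : ℕ) < j := hij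
        omega) hG
    obtain ⟨l, rfl⟩ : ∃ l, n = (J + 1) + (l + 1) := by
      obtain ⟨l, hl⟩ := Nat.exists_eq_add_of_lt hlt
      exact ⟨l, by omega⟩
    -- the split `⊗ f = P ⊗ Q` after the first `J + 1` factors
    set P : 𝓢((Fin (J + 1) → (EuclideanSpace ℝ (Fin 4))), ℂ) :=
      SchwartzMap.tensorFin (J + 1) fun i => f (Fin.castAdd (l + 1) i) with hP_def
    set Q : 𝓢((Fin (l + 1) → (EuclideanSpace ℝ (Fin 4))), ℂ) :=
      SchwartzMap.tensorFin (l + 1) fun j => f (Fin.natAdd (J + 1) j) with hQ_def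
    have hP : IsTimeOrdered P :=
      Density.isTimeOrdered_tensorFin_windowed (fun i => ha _)
        (fun i j hij => hab (Fin.castAdd (l + 1) i) (Fin.castAdd (l + 1) j) hij) fun i => hf _
    have hQ : IsTimeOrdered Q :=
      Density.isTimeOrdered_tensorFin_windowed (fun j => ha _)
        (fun i j hij => hab (Fin.natAdd (J + 1) i) (Fin.natAdd (J + 1) j)
          (Nat.add_lt_add_left (Fin.lt_def.1 hij) (J + 1))) fun j => hf _
    obtain ⟨hPT, hQT⟩ := Density.levels_of_windowed (f := f) hab hf
    -- the stretched products are tensor products of stretched windowed data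
    have hid : ∀ s : ℝ, P.appendTensor (translateMulti (SchwingerFamily.timeVec s) Q) =
        SchwartzMap.tensorFin ((J + 1) + (l + 1)) (Fin.append (fun i => f (Fin.castAdd (l + 1) i))
          fun j => translateTest (SchwingerFamily.timeVec s) (f (Fin.natAdd (J + 1) j))) :=
      fun s => Density.appendTensor_translateMulti_tensorFin _ _ _
    have hfar : ∀ s : ℝ, 2 * ρ ≤ s → 0 ≤ s →
        ∀ hs : IsTimeOrdered (P.appendTensor (translateMulti (SchwingerFamily.timeVec s) Q)),
          ⟪χ, h.fieldVec ((J + 1) + (l + 1)) κ _ hs⟫_ℂ = 0 := by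
      intro s h2ρ hs0 hs
      have hs' : IsTimeOrdered (SchwartzMap.tensorFin ((J + 1) + (l + 1))
          (Fin.append (fun i => f (Fin.castAdd (l + 1) i))
            fun j => translateTest (SchwingerFamily.timeVec s) (f (Fin.natAdd (J + 1) j)))) := by
        rw [← hid s]; exact hs
      rw [fieldVec_congr h κ (hid s) hs hs']
      obtain ⟨ha', hab', hwide'⟩ := Density.windows_append_shift (l := l) ha hab hwide h2ρ hs0
      exact ih _ κ _ _ _ ρ ha' hab' (Density.tsupport_append_shift hf s) hwide' hs'
    -- back to `s = 0` by the one-gap principle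
    have hid0 : P.appendTensor (translateMulti (SchwingerFamily.timeVec 0) Q) =
        SchwartzMap.tensorFin ((J + 1) + (l + 1)) f := by
      rw [SchwingerFamily.timeVec_zero, translateMulti_zero, hP_def, hQ_def, ← tensorFin_add]
    have hs0 : IsTimeOrdered (P.appendTensor (translateMulti (SchwingerFamily.timeVec 0) Q)) := by
      rw [hid0]; exact hG
    have h0 := h_oneGap κ P Q _ hP hQ hPT hQT χ (2 * ρ) hfar 0 le_rfl hs0
    rwa [fieldVec_congr h κ hid0 hs0 hG] at h0

/-! ### E. Closure: labelled linearity of `F ↦ Ψ^κ_F` and windowed density -/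

/-- **`Ψ^κ_{F+G} = Ψ^κ_F + Ψ^κ_G`** in `ℋ` (labelled). -/
theorem fieldVec_add_labelled {ι : Type} {S : LabelledSchwingerFamily ι (EuclideanSpace ℝ (Fin 4))} (h : OSReconstructionNoE1 S)
    {n : ℕ} (κ : Fin n → ι) {F G : 𝓢((Fin n → (EuclideanSpace ℝ (Fin 4))), ℂ)} (hF : IsTimeOrdered F)
    (hG : IsTimeOrdered G) (hFG : IsTimeOrdered (F + G)) :
    h.fieldVec n κ (F + G) hFG = h.fieldVec n κ F hF + h.fieldVec n κ G hG := by
  rw [← sub_eq_zero, ← inner_self_eq_zero (𝕜 := ℂ)]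
  simp only [inner_sub_left, inner_sub_right, inner_add_left, inner_add_right,
    inner_fieldVec_fieldVec', osAdjoint_add, SchwartzMap.appendTensor_add_left,
    SchwartzMap.appendTensor_add_right, map_add]
  ring

/-- **`Ψ^κ_{cF} = c Ψ^κ_F`** in `ℋ` (labelled). -/
theorem fieldVec_smul_labelled {ι : Type} {S : LabelledSchwingerFamily ι (EuclideanSpace ℝ (Fin 4))} (h : OSReconstructionNoE1 S)
    {n : ℕ} (κ : Fin n → ι) (c : ℂ) {F : 𝓢((Fin n → (EuclideanSpace ℝ (Fin 4))), ℂ)}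
    (hF : IsTimeOrdered F) (hcF : IsTimeOrdered (c • F)) :
    h.fieldVec n κ (c • F) hcF = c • h.fieldVec n κ F hF := by
  rw [← sub_eq_zero, ← inner_self_eq_zero (𝕜 := ℂ)]
  simp only [inner_sub_left, inner_sub_right, inner_smul_left, inner_smul_right,
    inner_fieldVec_fieldVec', Literature.MathematicalPhysics.QuantumLattice.osAdjoint_smul,
    SchwartzMap.appendTensor_smul_left, SchwartzMap.appendTensor_smul_right, map_smul, smul_eq_mul]
  ring

/-- **`Ψ^κ_0 = 0`** (labelled). -/
theorem fieldVec_zero_labelled {ι : Type} {S : LabelledSchwingerFamily ι (EuclideanSpace ℝ (Fin 4))} (h : OSReconstructionNoE1 S)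
    {n : ℕ} (κ : Fin n → ι) (h0 : IsTimeOrdered (0 : 𝓢((Fin n → (EuclideanSpace ℝ (Fin 4))), ℂ))) :
    h.fieldVec n κ 0 h0 = 0 := by
  rw [← inner_self_eq_zero (𝕜 := ℂ), inner_fieldVec_fieldVec']
  have : ((osAdjoint (0 : 𝓢((Fin n → (EuclideanSpace ℝ (Fin 4))), ℂ))).appendTensor (0 : 𝓢((Fin n → (EuclideanSpace ℝ (Fin 4))), ℂ))) = 0 := by
    ext x; simp
  rw [this, map_zero]

/-- **The span of the windowed tensor products, LABELLED**: every element is time-ordered and, if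
`χ` is orthogonal to all `Ψ^κ` of windowed tensor products, orthogonal to `χ`. -/
theorem inner_eq_zero_of_mem_span_windowed_labelled {ι : Type} (S : LabelledSchwingerFamily ι (EuclideanSpace ℝ (Fin 4)))
    (h : OSReconstructionNoE1 S) (χ : h.Hilbert) {n : ℕ} (κ : Fin n → ι)
    (hW : ∀ (f : Fin n → 𝓢((EuclideanSpace ℝ (Fin 4)), ℂ)) (a b : Fin n → ℝ) (ρ : ℝ),
      (∀ i, 0 < a i) → (∀ i j, i < j → b i < a j) →
      (∀ i, tsupport (f i : (EuclideanSpace ℝ (Fin 4)) → ℂ) ⊆ {x | a i ≤ x 0 ∧ x 0 ≤ b i ∧ |x 1| ≤ ρ}) →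
      ∀ hG : IsTimeOrdered (SchwartzMap.tensorFin n f),
        ⟪χ, h.fieldVec n κ (SchwartzMap.tensorFin n f) hG⟫_ℂ = 0)
    {G : 𝓢((Fin n → (EuclideanSpace ℝ (Fin 4))), ℂ)}
    (hGW : G ∈ (Submodule.span ℂ
      {G : 𝓢((Fin n → (EuclideanSpace ℝ (Fin 4))), ℂ) |
        ∃ (f : Fin n → 𝓢((EuclideanSpace ℝ (Fin 4)), ℂ)) (a b : Fin n → ℝ) (ρ : ℝ),
        (∀ i, 0 < a i) ∧ (∀ i j, i < j → b i < a j) ∧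
        (∀ i, tsupport (f i : (EuclideanSpace ℝ (Fin 4)) → ℂ) ⊆ {x | a i ≤ x 0 ∧ x 0 ≤ b i ∧ |x 1| ≤ ρ}) ∧
        IsTensorOf G f} : Submodule ℂ 𝓢((Fin n → (EuclideanSpace ℝ (Fin 4))), ℂ))) :
    IsTimeOrdered G ∧ ∀ hG : IsTimeOrdered G, ⟪χ, h.fieldVec n κ G hG⟫_ℂ = 0 := by
  induction hGW using Submodule.span_induction with
  | mem G hG =>
    obtain ⟨f, a, b, ρ, ha, hab, hf, hGf⟩ := hG
    obtain rfl : G = SchwartzMap.tensorFin n f := hGf.unique (isTensorOf_tensorFin f)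
    exact ⟨Density.isTimeOrdered_tensorFin_windowed ha hab hf, hW f a b ρ ha hab hf⟩
  | zero =>
    refine ⟨fun x hx => ?_, fun h0 => by rw [fieldVec_zero_labelled h κ h0, inner_zero_right]⟩
    rw [FunLike.coe_zero, tsupport_zero] at hx
    exact absurd hx (Set.notMem_empty x)
  | add F G _ _ hF hG =>
    refine ⟨isTimeOrdered_add hF.1 hG.1, fun hFG => ?_⟩
    rw [fieldVec_add_labelled h κ hF.1 hG.1 hFG, inner_add_right, hF.2, hG.2, add_zero]
  | smul c F _ hF =>
    refine ⟨OSReconstructionNoE1.isTimeOrdered_smul c hF.1, fun hcF => ?_⟩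
    rw [fieldVec_smul_labelled h κ c hF.1 hcF, inner_smul_right, hF.2, mul_zero]

/-- **CLOSURE, labelled**: orthogonality to all windowed tensor products of arity `n` (label `κ`)
gives orthogonality to `Ψ^κ_F` for every time-ordered `F` of arity `n` (`stub_windowedDensity`, landed
and label-free; linearity and continuity of `F ↦ Ψ^κ_F`). -/
theorem closure_labelled {ι : Type} (S : LabelledSchwingerFamily ι (EuclideanSpace ℝ (Fin 4))) (h : OSReconstructionNoE1 S)
    (χ : h.Hilbert) {n : ℕ} (κ : Fin n → ι)
    (hW : ∀ (f : Fin n → 𝓢((EuclideanSpace ℝ (Fin 4)), ℂ)) (a b : Fin n → ℝ) (ρ : ℝ),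
      (∀ i, 0 < a i) → (∀ i j, i < j → b i < a j) →
      (∀ i, tsupport (f i : (EuclideanSpace ℝ (Fin 4)) → ℂ) ⊆ {x | a i ≤ x 0 ∧ x 0 ≤ b i ∧ |x 1| ≤ ρ}) →
      ∀ hG : IsTimeOrdered (SchwartzMap.tensorFin n f),
        ⟪χ, h.fieldVec n κ (SchwartzMap.tensorFin n f) hG⟫_ℂ = 0)
    (F : 𝓢((Fin n → (EuclideanSpace ℝ (Fin 4))), ℂ)) (hF : IsTimeOrdered F) :
    ⟪χ, h.fieldVec n κ F hF⟫_ℂ = 0 := by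
  obtain ⟨u, huW, hu⟩ := mem_closure_iff_seq_limit.1 (stub_windowedDensity F hF)
  have hP := fun j => inner_eq_zero_of_mem_span_windowed_labelled S h χ κ hW (huW j)
  have ht : Tendsto (fun j => ⟪χ, h.fieldVec n κ (u j) (hP j).1⟫_ℂ) atTop
      (𝓝 ⟪χ, h.fieldVec n κ F hF⟫_ℂ) :=
    (tendsto_const_nhds (x := χ)).inner (tendsto_fieldVec h κ (fun j => (hP j).1) hF hu)
  have h0 : Tendsto (fun j => ⟪χ, h.fieldVec n κ (u j) (hP j).1⟫_ℂ) atTop (𝓝 0) := by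
    have : ∀ j, ⟪χ, h.fieldVec n κ (u j) (hP j).1⟫_ℂ = 0 := fun j => (hP j).2 _
    simp only [this]; exact tendsto_const_nhds
  exact tendsto_nhds_unique ht h0

/-! ### The piece -/

/-- **LABELLED TOTALITY of field vectors**: a vector orthogonal to every `Ψ^κ_F` is zero. -/
theorem eq_zero_of_forall_inner_fieldVec_eq_zero_labelled {ι : Type}
    {S : LabelledSchwingerFamily ι (EuclideanSpace ℝ (Fin 4))} (h : OSReconstructionNoE1 S) (χ : h.Hilbert)
    (hχ : ∀ (n : ℕ) (κ : Fin n → ι) (F : 𝓢((Fin n → (EuclideanSpace ℝ (Fin 4))), ℂ)) (hF : IsTimeOrdered F),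
      ⟪χ, h.fieldVec n κ F hF⟫_ℂ = 0) :
    χ = 0 := by
  have hall : ∀ x : h.Hilbert, ⟪χ, x⟫_ℂ = 0 := by
    intro x
    refine h.denseRange_vec.induction_on x (isClosed_eq (continuous_const.inner continuous_id)
      continuous_const) fun v => ?_
    rw [h.vec_eq_sum_genVec, Finsupp.sum, inner_sum]
    refine Finset.sum_eq_zero fun p _ => ?_
    rw [inner_smul_right]
    obtain ⟨n, k, F, hF⟩ := p
    have : h.genVec ⟨n, k, F, hF⟩ = h.fieldVec n k F hF := (h.fieldVec_eq_genVec n k F hF).symm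
    rw [this, hχ n k F hF, mul_zero]
  exact inner_self_eq_zero.1 (hall χ)

end DensityL

open DensityL OneGapL in
/-- **`TransparentRPWall.LabelledConeChainDensity` (stmt-QuantumFields-18619) — PROOF.** In the `e₀` OS
space of ANY labelled Schwinger family with E2 and translations on `⁰𝒮`, the field vectors of strict
cone chains (all arities, all label strings) span a dense subspace: `Dense ↔ (span)ᗮ = ⊥`; a vector `χ`
orthogonal to the span is orthogonal to every cone-chain vector, hence (induction over the gaps with the
labelled one-gap lemma, `J = n`) to every windowed tensor product, hence (closure) to every field vector,
hence zero (labelled totality). The statement is INLINE (verbatim the body of the route decl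
`Summit.QuantumFields.QCD.Theses.TransparentRPWall.LabelledConeChainDensity`). [folklore] -/
theorem labelledConeChainDensity_proof :
    (open Literature.MathematicalPhysics.QuantumLattice Literature.MathematicalPhysics.AQFT Literature.MathematicalPhysics.QuantumFieldTheory in let E := EuclideanSpace ℝ (Fin 4); ∀ (ι : Type) (S : LabelledSchwingerFamily ι E) (h : OSReconstructionNoE1 S), Dense ((Submodule.span ℂ {ψ : h.Hilbert | ∃ (m : ℕ) (k : Fin m → ι) (G : SchwartzMap (Fin m → E) ℂ) (hG : IsTimeOrdered G), tsupport (G : (Fin m → E) → ℂ) ⊆ {x | (∀ i, |x i 1| < x i 0) ∧ ∀ i j, i < j → |x j 1 - x i 1| < x j 0 - x i 0} ∧ ψ = h.fieldVec m k G hG} : Submodule ℂ h.Hilbert) : Set h.Hilbert)) := by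
  intro E ι S h
  rw [Submodule.dense_iff_topologicalClosure_eq_top, Submodule.topologicalClosure_eq_top_iff,
    Submodule.eq_bot_iff]
  intro χ hχ
  -- `χ` is orthogonal to every cone-chain vector
  have hχ' : ∀ (m : ℕ) (κ : Fin m → ι) (G : 𝓢((Fin m → (EuclideanSpace ℝ (Fin 4))), ℂ)) (hG : IsTimeOrdered G),
      tsupport (G : (Fin m → (EuclideanSpace ℝ (Fin 4))) → ℂ) ⊆
        {x | (∀ i, |x i 1| < x i 0) ∧ ∀ i j, i < j → |x j 1 - x i 1| < x j 0 - x i 0} →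
      ⟪χ, h.fieldVec m κ G hG⟫_ℂ = 0 := by
    intro m κ G hG hC
    have hk : h.fieldVec m κ G hG ∈ Submodule.span ℂ
        {ψ : h.Hilbert | ∃ (m : ℕ) (k : Fin m → ι) (G : 𝓢((Fin m → (EuclideanSpace ℝ (Fin 4))), ℂ)) (hG : IsTimeOrdered G),
          tsupport (G : (Fin m → (EuclideanSpace ℝ (Fin 4))) → ℂ) ⊆
            {x | (∀ i, |x i 1| < x i 0) ∧ ∀ i j, i < j → |x j 1 - x i 1| < x j 0 - x i 0} ∧
          ψ = h.fieldVec m k G hG} :=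
      Submodule.subset_span ⟨m, κ, G, hG, hC, rfl⟩
    rw [← inner_conj_symm, Submodule.inner_right_of_mem_orthogonal hk hχ, map_zero]
  -- hence to every windowed tensor product (`J = n`: no pair of windows is constrained)
  have hwin : ∀ (n : ℕ) (κ : Fin n → ι) (f : Fin n → 𝓢((EuclideanSpace ℝ (Fin 4)), ℂ)) (a b : Fin n → ℝ) (ρ : ℝ),
      (∀ i, 0 < a i) → (∀ i j, i < j → b i < a j) →
      (∀ i, tsupport (f i : (EuclideanSpace ℝ (Fin 4)) → ℂ) ⊆ {x | a i ≤ x 0 ∧ x 0 ≤ b i ∧ |x 1| ≤ ρ}) →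
      ∀ hG : IsTimeOrdered (SchwartzMap.tensorFin n f),
        ⟪χ, h.fieldVec n κ (SchwartzMap.tensorFin n f) hG⟫_ℂ = 0 := by
    intro n κ f a b ρ ha hab hf hG
    exact inner_tensorFin_eq_zero_of_wideFrom_labelled S h (fun κ' P Q T => oneGap_labelled S h κ' P Q T)
      χ hχ' n n κ f a b ρ ha hab hf
      (fun i j _ hJ => by
        have h1 := i.isLt
        omega) hG
  -- hence to every field vector, hence zero
  refine eq_zero_of_forall_inner_fieldVec_eq_zero_labelled h χ fun n κ F hF => ?_
  exact closure_labelled S h χ κ (hwin n κ) F hF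

end Summit.QuantumFields.QCD.Theorems.LabelledConeChainDensityProof

end
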